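import Summits.PneNP.PneNP.Theorems.SzkEntropyPeaWorstToAvgDualModeCompileAdviceElimCount
import Summits.PneNP.PneNP.Theorems.SzkEntropyPeaWorstToAvgDualMode

/-!
# Route SzkEntropy, crux `PeaWorstToAvg` (stmt-PneNP-10777), line `dual-mode-compile`, stub `stub_adviceElim`:
# true error rates, the padded bad set, and the bad inputs of the uniform scheme

Support file (3) for the stub `stub_adviceElim` (advice elimination by labelled self-testing), on top of
`…AdviceElimExperiment.lean` / `…AdviceElimCount.lean`.  The two facts tying the counting core to the hard
ensemble `D = ½ K₀ + ½ K₁` (`K_b` the law of the uniform sampler `S_b` on `1ⁿ`, supported on instances of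
label `b`):

* **`ofReal_rate_eq`** — the true error rate of a candidate on a uniformly random LABELLED SAMPLE BLOCK is
  its average error over the ensemble: `rate c = E_{y ∼ Dₙ} e_c(y)`, `e_c(y) = Pr_Z[maj_c(y; Z) ≠ label y]`
  (counting the block `b · r · Z` coordinate by coordinate: `cnt_succ`, `cnt_add_eq_sum_vector`, and the
  push-forward of the sampler's coins `sum_vector_eq_tsum_cnt`);
* **`toOuterMeasure_padBad_le`** — the inputs that are bad for `A` AT THEIR OWN PADDED PARAMETER have
  `Dₙ`-mass `≤ (T + 1)/M` (union over the `T + 1` lengths, as in `toOuterMeasure_badPadded_le`), whence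
  **`rate_true_le`**: the true budget has rate `≤ (T+1)/M + exp(−k/32)`;

and the conclusion **`toOuterMeasure_bad_out_le`**: if the threshold separates the true budget from the
candidates of rate `≥ β` and `Good` fails with probability `≤ 1/16`, the inputs on which the uniform scheme
errs with probability `≥ 1/4` have `Dₙ`-mass `≤ 16β/3` (on them the `Good`-part of the error,
`g(y) = Σ_c Pr[Good ∧ sel = c] e_c(y)`, is `≥ 3/16`, while `E_D g ≤ β` — Markov).

References: A. Bogdanov, L. Trevisan, *Average-Case Complexity* (2006), Def. 2.12–2.13, Lemma 3.2;
R. Impagliazzo, A. Wigderson, JCSS 63 (2001), Lemma 14; S. Arora, B. Barak (2009), §7.4.1, Thm. 7.10.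
-/

noncomputable section

open _root_.Computability
open Literature.Computability.Complexity Literature.Computability.MetaComplexity
open Summit.PneNP.PneNP.Theorems (tsum_mul_le_toOuterMeasure_add mul_toOuterMeasure_compl_le_tsum)
open Finset
open scoped ENNReal

namespace Summit.PneNP.PneNP.Cruxes.PeaWorstToAvg.DualModeCompile

set_option linter.dupNamespace false -- `Summit.PneNP.PneNP.…`: summit = sub-problem name (D-0017 single-conjunct layout)

namespace AdviceElim

/-! ### Counting probabilities in `ℝ≥0∞` -/

/-- A counting probability in `ℝ≥0∞`: `Pr = cnt · (2⁻¹)^m`. [folklore] -/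
theorem ofReal_uniformProb (m : ℕ) (E : Set (List Bool)) :
    ENNReal.ofReal (uniformProb m E) = (cnt m E : ℝ≥0∞) * 2⁻¹ ^ m := by
  rw [uniformProb_eq_cnt_div, ENNReal.ofReal_div_of_pos (by positivity), ENNReal.ofReal_natCast,
    ENNReal.ofReal_pow (by norm_num), ENNReal.ofReal_ofNat, div_eq_mul_inv, ENNReal.inv_pow]

/-- The point masses of the output law of a sampler, as counts (`RandAlg.toReal_outputPMF_apply` in
`ℝ≥0∞`). [AroraBarak2009, §7.1] -/
theorem outputPMF_apply_eq_cnt (B : RandAlg ℕ (List Bool)) (n : ℕ) (y : List Bool) :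
    B.outputPMF unaryEncodeNat n y =
      (cnt (B.coinLen (unaryEncodeNat n).length) {r | B.run n r = y} : ℝ≥0∞) *
        2⁻¹ ^ (B.coinLen (unaryEncodeNat n).length) := by
  rw [← ENNReal.ofReal_toReal (PMF.apply_ne_top _ _), RandAlg.toReal_outputPMF_apply,
    ← uniformProb_eq_cnt_div, ofReal_uniformProb]

/-- **Push-forward of a finite sum of coin strings**: `Σ_{r ∈ {0,1}^m} g (f r) = Σ_y #{r | f r = y} · g y`.
[folklore] -/
theorem sum_vector_eq_tsum_cnt (m : ℕ) (f : List Bool → List Bool) (g : List Bool → ℝ≥0∞) :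
    ∑ r : List.Vector Bool m, g (f r.toList) = ∑' y, (cnt m {r | f r = y} : ℝ≥0∞) * g y := by
  classical
  have h1 : ∀ r : List.Vector Bool m, g (f r.toList) = ∑' y, if y = f r.toList then g y else 0 :=
    fun r => by rw [tsum_ite_eq]
  simp_rw [h1]
  rw [← tsum_fintype (L := SummationFilter.unconditional (List.Vector Bool m)), ENNReal.tsum_comm]
  refine tsum_congr fun y => ?_
  rw [tsum_fintype, sum_ite, sum_const_zero, add_zero, sum_const, nsmul_eq_mul]
  congr 1
  have hc : (univ.filter fun r : List.Vector Bool m => y = f r.toList).card = cnt m {r | f r = y} := by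
    unfold cnt
    congr 1
    ext r
    simp only [mem_filter, mem_univ, true_and, Set.mem_setOf_eq]
    exact eq_comm
  rw [hc]

/-- Expectations under the fair mixture. [folklore] -/
theorem tsum_mixEnsemble_mul (K₀ K₁ : Ensemble) (n : ℕ) (h : List Bool → ℝ≥0∞) :
    ∑' y, mixEnsemble K₀ K₁ n y * h y = 2⁻¹ * ∑' y, K₀ n y * h y + 2⁻¹ * ∑' y, K₁ n y * h y := by
  simp_rw [mixEnsemble_apply, add_mul, mul_assoc]
  rw [ENNReal.tsum_add, ENNReal.tsum_mul_left, ENNReal.tsum_mul_left]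

/-! ### The true error rate is the average error over the ensemble -/

variable {A : RandAlg (List Bool × ℕ × ℕ) Bool} {S : Bool → RandAlg ℕ (List Bool)}

/-- Counting the error event of candidate `c` over the blocks with label bit `b`: split off the sampler's
coins `r`. [folklore] -/
theorem cnt_cons_errBit (pm : Params) (c : ℕ) (b : Bool) :
    cnt (pm.cn + pm.k * pm.P) {w | b :: w ∈ {blk | errBit A S pm c blk = true}} =
      ∑ r : List.Vector Bool pm.cn,
        cnt (pm.k * pm.P) {Z | maj A (query pm.G pm.n ((S b).run pm.n r.toList)) c pm.k Z ≠ b} := by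
  rw [cnt_add_eq_sum_vector]
  refine sum_congr rfl fun r _ => cnt_congr fun Z _ => ?_
  have hr : r.toList.length = pm.cn := r.toList_length
  have e1 : (b :: (r.toList ++ Z)).drop 1 = r.toList ++ Z := rfl
  have e2 : (b :: (r.toList ++ Z)).drop (1 + pm.cn) = Z := by
    rw [Nat.add_comm, List.drop_succ_cons, List.drop_left' hr]
  simp only [Set.mem_setOf_eq, errBit, inst, List.headD_cons, e1, e2, List.take_left' hr, decide_eq_true_eq]

/-- **The true error rate of a candidate is its average error over the hard ensemble**:
`rate c = Σ_y D_n(y) · e_c(y)` with `D = ½ K₀ + ½ K₁`, `K_b` the law of `S_b(1ⁿ)` (exact budget `c(n)`), and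
`e_c(y) = Pr_Z[maj_c(y; Z) ≠ label y]` — because a uniformly random sample block IS a fair label bit `b`, a
sample `y ∼ K_b`, and fresh amplification coins, and `K_b` is supported on instances of label `b`.
[BogdanovTrevisan2006, Def. 2.1, Def. 2.12] [Goldreich2001, §3.2.2] -/
theorem ofReal_rate_eq (pm : Params) (c : ℕ) {lab : List Bool → Bool}
    (hcn : ∀ b, (S b).coinLen (unaryEncodeNat pm.n).length = pm.cn)
    (hlab : ∀ b, ∀ y ∈ ((S b).outputPMF unaryEncodeNat pm.n).support, lab y = b) :
    ENNReal.ofReal (rate A S pm c) =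
      ∑' y, mixEnsemble (fun n => (S false).outputPMF unaryEncodeNat n)
          (fun n => (S true).outputPMF unaryEncodeNat n) pm.n y *
        ENNReal.ofReal (uniformProb (pm.k * pm.P) {Z | maj A (query pm.G pm.n y) c pm.k Z ≠ lab y}) := by
  -- one component
  have hcomp : ∀ b : Bool, ∑' y, (S b).outputPMF unaryEncodeNat pm.n y *
      ENNReal.ofReal (uniformProb (pm.k * pm.P) {Z | maj A (query pm.G pm.n y) c pm.k Z ≠ lab y}) =
      2⁻¹ ^ pm.cn * 2⁻¹ ^ (pm.k * pm.P) *
        (cnt (pm.cn + pm.k * pm.P) {w | b :: w ∈ {blk | errBit A S pm c blk = true}} : ℝ≥0∞) := by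
    intro b
    have hsupp : ∀ r : List.Vector Bool pm.cn,
        (S b).run pm.n r.toList ∈ ((S b).outputPMF unaryEncodeNat pm.n).support := by
      intro r
      rw [RandAlg.outputPMF, PMF.mem_support_map_iff]
      exact ⟨⟨r.toList, by rw [hcn]; exact r.toList_length⟩, by simp, rfl⟩
    calc ∑' y, (S b).outputPMF unaryEncodeNat pm.n y *
          ENNReal.ofReal (uniformProb (pm.k * pm.P) {Z | maj A (query pm.G pm.n y) c pm.k Z ≠ lab y})
        = ∑' y, 2⁻¹ ^ pm.cn * 2⁻¹ ^ (pm.k * pm.P) * ((cnt pm.cn {r | (S b).run pm.n r = y} : ℝ≥0∞) *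
            (cnt (pm.k * pm.P) {Z | maj A (query pm.G pm.n y) c pm.k Z ≠ lab y} : ℝ≥0∞)) := by
          refine tsum_congr fun y => ?_
          rw [outputPMF_apply_eq_cnt, hcn, ofReal_uniformProb]
          ring
      _ = 2⁻¹ ^ pm.cn * 2⁻¹ ^ (pm.k * pm.P) * ∑ r : List.Vector Bool pm.cn,
            (cnt (pm.k * pm.P) {Z | maj A (query pm.G pm.n ((S b).run pm.n r.toList)) c pm.k Z ≠
              lab ((S b).run pm.n r.toList)} : ℝ≥0∞) := by
          rw [ENNReal.tsum_mul_left]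
          congr 1
          exact (sum_vector_eq_tsum_cnt pm.cn (fun l => (S b).run pm.n l) fun y =>
            (cnt (pm.k * pm.P) {Z | maj A (query pm.G pm.n y) c pm.k Z ≠ lab y} : ℝ≥0∞)).symm
      _ = 2⁻¹ ^ pm.cn * 2⁻¹ ^ (pm.k * pm.P) *
            (cnt (pm.cn + pm.k * pm.P) {w | b :: w ∈ {blk | errBit A S pm c blk = true}} : ℝ≥0∞) := by
          rw [cnt_cons_errBit, Nat.cast_sum]
          congr 1
          refine sum_congr rfl fun r _ => ?_
          rw [hlab b _ (hsupp r)]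
  -- the mixture
  rw [tsum_mixEnsemble_mul, hcomp false, hcomp true, rate, ofReal_uniformProb,
    show pm.L = (pm.cn + pm.k * pm.P) + 1 by unfold Params.L; ring, cnt_succ, Nat.cast_add]
  ring

/-! ### The padded bad set -/

/-- **Few inputs are bad at their own padded parameter.** If `A` has bad sets of `Dₙ`-mass `≤ 1/m` at every
`m > 0`, and `G ≥ 2T + 2n + 4 + M`, then the instances of length `≤ T` on whose padded query `A` errs with
probability `≥ 1/4` have `Dₙ`-mass `≤ (T + 1)/M`: they lie in `⋃_{j ≤ T} Bad(n, G − 2j − 2n − 4)` and each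
padded parameter is `≥ M`. [BogdanovTrevisan2006, Lemma 3.2 (proof: the bad set transfers)] -/
theorem toOuterMeasure_padBad_le {D : PMF (List Bool)} {lab : List Bool → Bool} {n G T M : ℕ}
    (hbad : ∀ m : ℕ, 0 < m →
      D.toOuterMeasure {x | 1 / 4 ≤ A.pr schemeEnc (x, n, m) {b | b ≠ lab x}} ≤ ((m : ℕ) : ℝ≥0∞)⁻¹)
    (hM : 0 < M) (hG : 2 * T + 2 * n + 4 + M ≤ G) :
    D.toOuterMeasure {y | y.length ≤ T ∧ 1 / 4 ≤ A.pr schemeEnc (query G n y) {b | b ≠ lab y}} ≤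
      (T + 1 : ℕ) * ((M : ℕ) : ℝ≥0∞)⁻¹ := by
  set κ : ℕ → ℕ := fun j => G - (2 * j + 2 * n + 4) with hκ
  have hcover : {y : List Bool | y.length ≤ T ∧ 1 / 4 ≤ A.pr schemeEnc (query G n y) {b | b ≠ lab y}} ⊆
      ⋃ j ∈ range (T + 1), {x | 1 / 4 ≤ A.pr schemeEnc (x, n, κ j) {b | b ≠ lab x}} := by
    rintro y ⟨hy, hbad'⟩
    simp only [Set.mem_iUnion, mem_range, Set.mem_setOf_eq, exists_prop]
    refine ⟨y.length, Nat.lt_succ_of_le hy, ?_⟩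
    have hq : query G n y = (y, n, κ y.length) := by
      simp only [query, padM, hκ, length_schemeEnc, add_zero]
    rwa [hq] at hbad'
  calc D.toOuterMeasure _ ≤ D.toOuterMeasure (⋃ j ∈ range (T + 1),
        {x | 1 / 4 ≤ A.pr schemeEnc (x, n, κ j) {b | b ≠ lab x}}) := D.toOuterMeasure.mono hcover
    _ ≤ ∑ j ∈ range (T + 1), D.toOuterMeasure {x | 1 / 4 ≤ A.pr schemeEnc (x, n, κ j) {b | b ≠ lab x}} :=
        MeasureTheory.measure_biUnion_finset_le _ _
    _ ≤ ∑ _j ∈ range (T + 1), ((M : ℕ) : ℝ≥0∞)⁻¹ := by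
        refine sum_le_sum fun j hj => ?_
        have hj : j ≤ T := Nat.lt_succ_iff.1 (mem_range.1 hj)
        have hκM : M ≤ κ j := by simp only [hκ]; omega
        exact (hbad (κ j) (by omega)).trans (ENNReal.inv_le_inv.2 (by exact_mod_cast hκM))
    _ = (T + 1 : ℕ) * ((M : ℕ) : ℝ≥0∞)⁻¹ := by rw [sum_const, card_range, nsmul_eq_mul]

/-- **The true budget has small rate**: if the samplers' outputs have length `≤ T`, `G ≥ 2T + 2n + 4 + M`,
`c⋆ = coinLen_A G ≤ P` and `k > 0`, then `rate c⋆ ≤ (T+1)/M + exp(−k/32)` — outside the padded bad set the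
amplified vote at the true budget errs with probability `≤ exp(−k/32)` (`uniformProb_maj_ne_le_exp`), and the
padded bad set has mass `≤ (T+1)/M`. [BogdanovTrevisan2006, Lemma 3.2; AroraBarak2009, Thm. 7.10] -/
theorem rate_true_le (pm : Params) {lab : List Bool → Bool} {T M : ℕ}
    (hcn : ∀ b, (S b).coinLen (unaryEncodeNat pm.n).length = pm.cn)
    (hlab : ∀ b, ∀ y ∈ ((S b).outputPMF unaryEncodeNat pm.n).support, lab y = b)
    (hsupp : ∀ b, ∀ y ∈ ((S b).outputPMF unaryEncodeNat pm.n).support, y.length ≤ T)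
    (hbad : ∀ m : ℕ, 0 < m →
      (mixEnsemble (fun n => (S false).outputPMF unaryEncodeNat n)
          (fun n => (S true).outputPMF unaryEncodeNat n) pm.n).toOuterMeasure
        {x | 1 / 4 ≤ A.pr schemeEnc (x, pm.n, m) {b | b ≠ lab x}} ≤ ((m : ℕ) : ℝ≥0∞)⁻¹)
    (hM : 0 < M) (hG : 2 * T + 2 * pm.n + 4 + M ≤ pm.G) (hP : A.coinLen pm.G ≤ pm.P) (hk : 0 < pm.k) :
    rate A S pm (A.coinLen pm.G) ≤ (T + 1 : ℝ) / M + Real.exp (-(pm.k / 32 : ℝ)) := by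
  set D : PMF (List Bool) := mixEnsemble (fun n => (S false).outputPMF unaryEncodeNat n)
    (fun n => (S true).outputPMF unaryEncodeNat n) pm.n with hD
  set B₀ : Set (List Bool) := {y | 1 / 4 ≤ A.pr schemeEnc (query pm.G pm.n y) {b | b ≠ lab y}} with hB₀
  have hsuppD : ∀ y ∈ D.support, y.length ≤ T := by
    intro y hy
    rcases (mem_support_mixEnsemble_iff _ _ pm.n y).1 hy with h | h
    · exact hsupp false y h
    · exact hsupp true y h
  have hlen : ∀ y : List Bool, y.length ≤ T → (schemeEnc (y, pm.n, 0)).length ≤ pm.G := by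
    intro y hy
    rw [length_schemeEnc]
    omega
  -- the average error at the true budget, split along `B₀`
  have h1 : ENNReal.ofReal (rate A S pm (A.coinLen pm.G)) ≤
      D.toOuterMeasure B₀ + ENNReal.ofReal (Real.exp (-(pm.k / 32 : ℝ))) := by
    rw [ofReal_rate_eq pm _ hcn hlab]
    refine tsum_mul_le_toOuterMeasure_add D _ B₀ _ (fun y => ENNReal.ofReal_le_one.2 (uniformProb_le_one _ _))
      fun y hy hyB => ENNReal.ofReal_le_ofReal ?_
    exact uniformProb_maj_ne_le_exp A hk (hlen y (hsuppD y hy)) hP (not_le.1 hyB)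
  have h2 : D.toOuterMeasure B₀ ≤ (T + 1 : ℕ) * ((M : ℕ) : ℝ≥0∞)⁻¹ := by
    rw [← PMF.toOuterMeasure_apply_inter_support]
    refine (D.toOuterMeasure.mono ?_).trans (toOuterMeasure_padBad_le hbad hM hG)
    exact fun y hy => ⟨hsuppD y hy.2, hy.1⟩
  have h3 : ENNReal.ofReal (rate A S pm (A.coinLen pm.G)) ≤
      ENNReal.ofReal ((T + 1 : ℝ) / M + Real.exp (-(pm.k / 32 : ℝ))) := by
    refine (h1.trans (add_le_add h2 le_rfl)).trans (le_of_eq ?_)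
    have hMr : (0 : ℝ) < M := by exact_mod_cast hM
    have e1 : ENNReal.ofReal ((T + 1 : ℝ) / M) = (T + 1 : ℕ) * ((M : ℕ) : ℝ≥0∞)⁻¹ := by
      rw [ENNReal.ofReal_div_of_pos hMr, div_eq_mul_inv, ENNReal.ofReal_natCast,
        show ((T : ℝ) + 1) = ((T + 1 : ℕ) : ℝ) by push_cast; ring, ENNReal.ofReal_natCast]
    rw [ENNReal.ofReal_add (by positivity) (Real.exp_pos _).le, e1]
  exact (ENNReal.ofReal_le_ofReal_iff (by positivity)).1 h3

/-! ### The bad inputs of the uniform scheme -/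

/-- **The bad inputs of the uniform scheme have small mass.**  Assume: the samplers use exactly `c(n)`
coins, their outputs are labelled (`label = b` on the support of `K_b`) and of length `≤ T`; `A` has bad sets
of `Dₙ`-mass `≤ 1/m` at every `m > 0` (`HeurBPP`); `G ≥ 2T + 2n + 4 + M`, `c⋆ = coinLen_A G ≤ P`, `k, N > 0`;
and the reals `ρ ≥ (T+1)/M + exp(−k/32)` (a bound for `rate c⋆`, `rate_true_le`), `θ ≥ 0`, `β` satisfy
`N (ρ + θ) ≤ τ ≤ N (β − θ)` and `(P + 2) exp(−θ² N/2) ≤ 1/16`.  Then the instances `y` on which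
`Pr_R[out(y; R) ≠ label y] ≥ 1/4` have `Dₙ`-mass `≤ 16β/3`.  Proof: `Pr_R[out(y; R) ≠ label y] ≤ 1/16 + g(y)`
with `g(y) = Σ_{c ≤ P} Pr_t[Good ∧ sel = c] · e_c(y)` (`uniformProb_out_ne_le`, `uniformProb_compl_good_le`),
and `E_{Dₙ} g = Σ_c Pr_t[Good ∧ sel = c] · rate c ≤ β` (`ofReal_rate_eq`; on `Good` the selected candidate
has rate `< β`; the weights sum to `≤ 1`), so Markov bounds `Dₙ{g ≥ 3/16}`.
[BogdanovTrevisan2006, Def. 2.12–2.13, Lemma 3.2] [ImpagliazzoWigderson2001, Lemma 14] -/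
theorem toOuterMeasure_bad_out_le (pm : Params) {lab : List Bool → Bool} {T M : ℕ} {θ β ρ : ℝ}
    (hcn : ∀ b, (S b).coinLen (unaryEncodeNat pm.n).length = pm.cn)
    (hlab : ∀ b, ∀ y ∈ ((S b).outputPMF unaryEncodeNat pm.n).support, lab y = b)
    (hsupp : ∀ b, ∀ y ∈ ((S b).outputPMF unaryEncodeNat pm.n).support, y.length ≤ T)
    (hbad : ∀ m : ℕ, 0 < m →
      (mixEnsemble (fun n => (S false).outputPMF unaryEncodeNat n)
          (fun n => (S true).outputPMF unaryEncodeNat n) pm.n).toOuterMeasure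
        {x | 1 / 4 ≤ A.pr schemeEnc (x, pm.n, m) {b | b ≠ lab x}} ≤ ((m : ℕ) : ℝ≥0∞)⁻¹)
    (hM : 0 < M) (hG : 2 * T + 2 * pm.n + 4 + M ≤ pm.G) (hP : A.coinLen pm.G ≤ pm.P) (hk : 0 < pm.k)
    (hN : 0 < pm.N) (hθ : 0 ≤ θ) (hρ : (T + 1 : ℝ) / M + Real.exp (-(pm.k / 32 : ℝ)) ≤ ρ)
    (h₁ : (pm.N : ℝ) * (ρ + θ) ≤ pm.τ) (h₂ : (pm.τ : ℝ) ≤ pm.N * (β - θ))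
    (hδ : (pm.P + 2 : ℝ) * Real.exp (-(θ ^ 2 * pm.N / 2)) ≤ 1 / 16) :
    (mixEnsemble (fun n => (S false).outputPMF unaryEncodeNat n)
        (fun n => (S true).outputPMF unaryEncodeNat n) pm.n).toOuterMeasure
      {y | 1 / 4 ≤ uniformProb pm.total {R | out A S pm y R ≠ lab y}} ≤ ENNReal.ofReal (16 * β / 3) := by
  set D : PMF (List Bool) := mixEnsemble (fun n => (S false).outputPMF unaryEncodeNat n)
    (fun n => (S true).outputPMF unaryEncodeNat n) pm.n with hD
  set cs : ℕ := A.coinLen pm.G with hcs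
  -- the true budget has small rate, so `Good` fails rarely
  have hrate : rate A S pm cs ≤ ρ := (rate_true_le pm hcn hlab hsupp hbad hM hG hP hk).trans hρ
  have h₁' : (pm.N : ℝ) * (rate A S pm cs + θ) ≤ pm.τ :=
    le_trans (mul_le_mul_of_nonneg_left (by linarith) (Nat.cast_nonneg _)) h₁
  have hgood : uniformProb pm.testLen (Good A S pm cs β)ᶜ ≤ 1 / 16 :=
    (uniformProb_compl_good_le hP hN hθ h₁' h₂).trans hδ
  -- the selection weights, the per-candidate errors and the `Good` part `g` of the error
  set w : ℕ → ℝ := fun c => uniformProb pm.testLen {t | t ∈ Good A S pm cs β ∧ sel A S pm t = some c} with hw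
  set e : ℕ → List Bool → ℝ := fun c y =>
    uniformProb (pm.k * pm.P) {z | maj A (query pm.G pm.n y) c pm.k z ≠ lab y} with he
  set g : List Bool → ℝ := fun y => ∑ c ∈ range (pm.P + 1), w c * e c y with hg
  have hpt : ∀ y, uniformProb pm.total {R | out A S pm y R ≠ lab y} ≤ 1 / 16 + g y := fun y =>
    (uniformProb_out_ne_le pm y (lab y) fun t _ ht => sel_ne_none_of_mem_good hP ht).trans
      (add_le_add hgood le_rfl)
  -- on a selected candidate the rate is `< β`
  have hwβ : ∀ c ∈ range (pm.P + 1),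
      ENNReal.ofReal (w c) * ENNReal.ofReal (rate A S pm c) ≤ ENNReal.ofReal (w c) * ENNReal.ofReal β := by
    intro c _
    by_cases hwc : w c = 0
    · simp [hwc]
    · have hpos : 0 < cnt pm.testLen {t | t ∈ Good A S pm cs β ∧ sel A S pm t = some c} := by
        rw [Nat.pos_iff_ne_zero]
        intro h0
        apply hwc
        simp only [hw, uniformProb_eq_cnt_div, h0, Nat.cast_zero, zero_div]
      obtain ⟨t, -, ht, hsel⟩ := (cnt_pos_iff _ _).1 hpos
      gcongr
      exact (rate_lt_of_mem_good ht hsel).le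
  -- the average of `g` is at most `β`
  have hgy : ∀ y, ENNReal.ofReal (g y) =
      ∑ c ∈ range (pm.P + 1), ENNReal.ofReal (w c) * ENNReal.ofReal (e c y) := by
    intro y
    rw [hg, ENNReal.ofReal_sum_of_nonneg (fun c _ => mul_nonneg (uniformProb_nonneg _ _) (uniformProb_nonneg _ _))]
    exact sum_congr rfl fun c _ => ENNReal.ofReal_mul (uniformProb_nonneg _ _)
  have havg : ∑' y, D y * ENNReal.ofReal (g y) ≤ ENNReal.ofReal β :=
    calc ∑' y, D y * ENNReal.ofReal (g y)
        = ∑' y, ∑ c ∈ range (pm.P + 1), ENNReal.ofReal (w c) * (D y * ENNReal.ofReal (e c y)) := by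
          refine tsum_congr fun y => ?_
          rw [hgy, mul_sum]
          exact sum_congr rfl fun c _ => by ring
      _ = ∑ c ∈ range (pm.P + 1), ENNReal.ofReal (w c) * ∑' y, D y * ENNReal.ofReal (e c y) := by
          rw [Summable.tsum_finsetSum fun _ _ => ENNReal.summable]
          exact sum_congr rfl fun c _ => ENNReal.tsum_mul_left
      _ = ∑ c ∈ range (pm.P + 1), ENNReal.ofReal (w c) * ENNReal.ofReal (rate A S pm c) := by
          refine sum_congr rfl fun c _ => ?_
          rw [ofReal_rate_eq pm c hcn hlab]
      _ ≤ ∑ c ∈ range (pm.P + 1), ENNReal.ofReal (w c) * ENNReal.ofReal β := sum_le_sum hwβ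
      _ = ENNReal.ofReal (∑ c ∈ range (pm.P + 1), w c) * ENNReal.ofReal β := by
          rw [← sum_mul, ENNReal.ofReal_sum_of_nonneg fun c _ => uniformProb_nonneg _ _]
      _ ≤ 1 * ENNReal.ofReal β := by
          gcongr
          exact ENNReal.ofReal_le_one.2 (sum_uniformProb_select_le_one _ _ _ _)
      _ = ENNReal.ofReal β := one_mul _
  -- Markov
  have hmarkov : ENNReal.ofReal (3 / 16) * D.toOuterMeasure {y | g y < 3 / 16}ᶜ ≤ ENNReal.ofReal β :=
    (mul_toOuterMeasure_compl_le_tsum D (fun y => ENNReal.ofReal (g y)) {y | g y < 3 / 16}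
      (ENNReal.ofReal (3 / 16)) fun y _ hy => ENNReal.ofReal_le_ofReal (not_lt.1 hy)).trans havg
  have hsub : {y | 1 / 4 ≤ uniformProb pm.total {R | out A S pm y R ≠ lab y}} ⊆ {y | g y < 3 / 16}ᶜ := by
    intro y hy
    simp only [Set.mem_compl_iff, Set.mem_setOf_eq, not_lt] at hy ⊢
    linarith [hpt y]
  calc D.toOuterMeasure _ ≤ D.toOuterMeasure {y | g y < 3 / 16}ᶜ := D.toOuterMeasure.mono hsub
    _ ≤ ENNReal.ofReal β / ENNReal.ofReal (3 / 16) := by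
        rw [ENNReal.le_div_iff_mul_le (Or.inl (ENNReal.ofReal_pos.2 (by norm_num)).ne')
          (Or.inl ENNReal.ofReal_ne_top), mul_comm]
        exact hmarkov
    _ = ENNReal.ofReal (16 * β / 3) := by
        rw [← ENNReal.ofReal_div_of_pos (by norm_num)]
        congr 1
        ring

end AdviceElim

/-- **Registered sub-goal of this file**: the inputs that are bad for `A` at their own padded parameter have
mass `≤ (T + 1)/M` (`AdviceElim.toOuterMeasure_padBad_le`). [BogdanovTrevisan2006, Lemma 3.2] -/
theorem adviceElim_padBad_le (A : RandAlg (List Bool × ℕ × ℕ) Bool) {D : PMF (List Bool)} {lab : List Bool → Bool}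
    {n G T M : ℕ} (hbad : ∀ m : ℕ, 0 < m →
      D.toOuterMeasure {x | 1 / 4 ≤ A.pr schemeEnc (x, n, m) {b | b ≠ lab x}} ≤ ((m : ℕ) : ENNReal)⁻¹)
    (hM : 0 < M) (hG : 2 * T + 2 * n + 4 + M ≤ G) :
    D.toOuterMeasure {y | y.length ≤ T ∧ 1 / 4 ≤ A.pr schemeEnc (AdviceElim.query G n y) {b | b ≠ lab y}} ≤
      (T + 1 : ℕ) * ((M : ℕ) : ENNReal)⁻¹ :=
  AdviceElim.toOuterMeasure_padBad_le hbad hM hG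

end Summit.PneNP.PneNP.Cruxes.PeaWorstToAvg.DualModeCompile

end
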